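import Literature.Computability.Complexity.FKPointLocationTree
import Literature.Computability.Complexity.FKPointLocationFormBounds
import Literature.Computability.Complexity.FKPointLocationParams
import Literature.Computability.Complexity.FournierKoiranTransferOracle
import Mathlib.Algebra.Polynomial.Eval.Defs
import HarnessLib

/-!
# Fournier–Koiran point location, non-uniform form, III: polynomial-depth sign-query trees

Topic `Literature/Computability/Complexity`, grouping namespace `FKPointLocation`. The assembly of
the non-uniform point-location theorem (Meyer auf der Heide 1984/1988; Fournier–Koiran 1998, 2000,
§2) in the tree's sign-oracle rendering (`AdditiveRealClasses.signOracle`: a query is the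
`encodingIntBool.listBool`-code of an integer affine form `[c, a₀, …, a_{n-1}]`, answered by the bit
`[0 ≤ c + ∑ aᵢ xᵢ]`):

* `treeParams n = paramsOf n (n+1)` (coefficient bound `B = 2^{n+1}`), the budget
  `treeBudget n = ((n+5)(n+3)³)^24` with its polynomial `treeBudgetPoly`, and the two estimates
  `length_agenda_treeParams_succ_le` (rounds) and `length_encHat_le_treeBudget` (query length);
* **`exists_treeAlg_of_signDetermined`** — for every `n` and every property `P` of points of `ℝⁿ`
  that is SIGN-DETERMINED at coefficient bound `2^{n+1}` (membership depends only on the signs of the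
  integer affine forms with coefficients and constant of absolute value `≤ 2^{n+1}`; e.g. a union of
  faces of an arrangement of such hyperplanes), there is a sign-query oracle algorithm (arbitrary
  step function: a linear decision tree) which, on every `x ∈ ℝⁿ`, within `treeBudget n` rounds and
  with queries of length `≤ treeBudget n`, outputs the bit `[P x]`. Proof: run the location protocol
  as a decision tree (`treeAlg_run`, `finalData_valid`), output `P` at the located rational point
  (`Cert.sign_lin_xStar_eq`, `affine_sign_agree_of_homogeneous`), bound the queries
  (`mem_queries_treeAlg`, `formBnd_queryForm_runFrom_take`).

## References

* F. Meyer auf der Heide, *A polynomial linear search algorithm for the n-dimensional knapsack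
  problem*, J. ACM 31 (1984) 668–676 (Thm 1: polynomial linear search trees for arrangements);
  *Fast algorithms for n-dimensional restrictions of hard problems*, J. ACM 35 (1988) 740–747.
  [Meyeraufderheide1984] [MeyerAufDerHeide1988]
* H. Fournier, P. Koiran, *Are lower bounds easier over the reals?*, STOC 1998, 507–513 (small
  coefficients: parameter-free trees). [FournierKoiran1998]
* H. Fournier, P. Koiran, *Lower bounds are not easier over the reals: inside PH*, ICALP 2000,
  LNCS 1853 = LIP RR-1999-21, §2 (Thm 2, §2.2 sizes, §2.3 homogenisation, §2.4). [FournierKoiran2000]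
-/

namespace Literature.Computability.Complexity

namespace FKPointLocation

open _root_.Computability Polynomial Finset

/-! ### The size exponent along the truthful run -/

section SizeExp

variable {Q : LevelParams}

/-- **The invariant along the truthful run of a prefix of the schedule**, with the uniform exponent
`W + 1 + |agenda|`. [cite: FournierKoiran2000, §2.2] -/
theorem bnd_runFrom_take (finT : Cert Q.D → Prop) (xh : Fin Q.D → ℝ) (s : ℕ) :
    Bnd (Q.W + 1 + (agenda Q).length) (agenda Q).length (runFrom Q finT xh (Data.init Q.D) ((agenda Q).take s)) := by
  have h0 : Bnd (Q.W + 1) 0 (Data.init Q.D) := bnd_init (by omega) 0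
  have h := bnd_runFrom (finT := finT) (xh := xh) le_rfl ((agenda Q).take s) 0 _ h0
  rw [zero_add] at h
  exact h.mono (by simp) ((List.take_sublist s (agenda Q)).length_le)

/-- The size exponent of the queried forms along the truthful run: with `T = |agenda Q|` and
`K = W + 1 + T`, `2K + L + 3 + T (2K + D + 2)`. [cite: FournierKoiran2000, §2.2] -/
def sizeExp (Q : LevelParams) : ℕ :=
  2 * (Q.W + 1 + (agenda Q).length) + Q.L + 3 +
    (agenda Q).length * (2 * (Q.W + 1 + (agenda Q).length) + Q.D + 2)

/-- **Every form queried along the truthful run is small**: at the state reached after any prefix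
of the schedule, the form of any task of the schedule has exponent `sizeExp Q`.
[cite: FournierKoiran2000, §2.2 (Cor. 2)] -/
theorem formBnd_queryForm_runFrom_take (finT : Cert Q.D → Prop) (xh : Fin Q.D → ℝ) (s : ℕ) {τ : Task Q.D}
    (hτ : τ ∈ agenda Q) :
    FormBnd (sizeExp Q) (queryForm (runFrom Q finT xh (Data.init Q.D) ((agenda Q).take s)) τ) :=
  formBnd_queryForm (bnd_runFrom_take finT xh s) hτ

/-- **Every form queried along the truthful run is small** (exponent `sizeExp Q`).
[cite: FournierKoiran2000, §2.2 (Cor. 2)] -/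
theorem formBnd_formAt (Q : LevelParams) (finT : Cert Q.D → Prop) (xh : Fin Q.D → ℝ) {s : ℕ}
    (hs : s < (agenda Q).length) : FormBnd (sizeExp Q) (formAt Q finT xh s) := by
  have hτ : taskAt Q s ∈ agenda Q := by
    simp only [taskAt, List.getElem?_eq_getElem hs, Option.getD_some]
    exact List.getElem_mem hs
  exact formBnd_queryForm_runFrom_take finT xh s hτ

end SizeExp

/-! ### Powers of the base `N = (n+5)(n+3)³` -/

section Arith

variable {N : ℕ}

/-- Bookkeeping (`a ≤ N^i`, `b ≤ N^j`, `i, j < k` give `a + b ≤ N^k` for `N ≥ 2`). [folklore] -/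
theorem add_le_pow_of_le (hN : 2 ≤ N) {a b i j k : ℕ} (ha : a ≤ N ^ i) (hb : b ≤ N ^ j) (hi : i < k) (hj : j < k) :
    a + b ≤ N ^ k := by
  have h1 : N ^ i ≤ N ^ (k - 1) := Nat.pow_le_pow_right (by omega) (by omega)
  have h2 : N ^ j ≤ N ^ (k - 1) := Nat.pow_le_pow_right (by omega) (by omega)
  have h3 : N ^ k = N * N ^ (k - 1) := by rw [← pow_succ']; congr 1; omega
  nlinarith

/-- Bookkeeping (`a ≤ N^i`, `b ≤ N^j`, `i + j ≤ k` give `a b ≤ N^k` for `N ≥ 1`). [folklore] -/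
theorem mul_le_pow_of_le (hN : 1 ≤ N) {a b i j k : ℕ} (ha : a ≤ N ^ i) (hb : b ≤ N ^ j) (hk : i + j ≤ k) :
    a * b ≤ N ^ k :=
  (Nat.mul_le_mul ha hb).trans (by rw [← pow_add]; exact Nat.pow_le_pow_right hN hk)

/-- Bookkeeping (`a ≤ N^i`, `i ≤ k` give `a ≤ N^k`). [folklore] -/
theorem le_pow_of_le_pow (hN : 1 ≤ N) {a i k : ℕ} (ha : a ≤ N ^ i) (hk : i ≤ k) : a ≤ N ^ k :=
  ha.trans (Nat.pow_le_pow_right hN hk)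

end Arith

/-! ### Parameters and budget of the tree -/

section Params

/-- The level parameters of the decision tree in dimension `n`: `paramsOf n (n+1)`, i.e. `D = n+1`
and coefficient bound `B = 2^{n+1}`. [cite: FournierKoiran2000, §2.1–2.3] -/
def treeParams (n : ℕ) : LevelParams := paramsOf n (n + 1)

/-- The base of the polynomial bounds: `N = (n+5)(n+3)³`. [folklore] -/
def base (n : ℕ) : ℕ := (n + 5) * (n + 3) ^ 3

/-- **The budget** (rounds and query length) of the tree: `((n+5)(n+3)³)^24`. [cite: FournierKoiran2000, Thm 2 (polynomial bounds)] -/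
def treeBudget (n : ℕ) : ℕ := base n ^ 24

/-- The budget as a polynomial. [folklore] -/
noncomputable def treeBudgetPoly : Polynomial ℕ := ((X + 5) * (X + 3) ^ 3) ^ 24

/-- `treeBudgetPoly` evaluates to `treeBudget`. [folklore] -/
@[simp] theorem eval_treeBudgetPoly (n : ℕ) : treeBudgetPoly.eval n = treeBudget n := by
  simp [treeBudgetPoly, treeBudget, base]

/-- `N ≥ 135`. [folklore] -/
theorem base_ge (n : ℕ) : 135 ≤ base n := by
  unfold base
  have h3 : 27 ≤ (n + 3) ^ 3 := by
    calc 27 = 3 ^ 3 := by norm_num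
      _ ≤ (n + 3) ^ 3 := Nat.pow_le_pow_left (by omega) 3
  nlinarith

/-- `27 (n + 5) ≤ N` (so every linear quantity in `n` met below is at most `N`). [folklore] -/
theorem linear_le_base (n : ℕ) : 27 * (n + 5) ≤ base n := by
  unfold base
  have h3 : 27 ≤ (n + 3) ^ 3 := by
    calc 27 = 3 ^ 3 := by norm_num
      _ ≤ (n + 3) ^ 3 := Nat.pow_le_pow_left (by omega) 3
  nlinarith

/-- `(n+1)(n+3) ≤ N`. [folklore] -/
theorem wf_le_base (n : ℕ) : (n + 1) * (n + 3) ≤ base n := by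
  unfold base
  have : (n + 3) ^ 3 = (n + 3) * (n + 3) * (n + 3) := by ring
  rw [this]; nlinarith [Nat.zero_le n]

/-- The dimension of `treeParams`. [folklore] -/
@[simp] theorem treeParams_D (n : ℕ) : (treeParams n).D = n + 1 := rfl

/-- The coefficient bound of `treeParams`. [folklore] -/
@[simp] theorem treeParams_B (n : ℕ) : (treeParams n).B = 2 ^ (n + 1) := rfl

/-- `D + 2 ≤ N`. [folklore] -/
theorem D_add_two_le (n : ℕ) : (treeParams n).D + 2 ≤ base n ^ 1 := by
  rw [treeParams_D, pow_one]; linarith [linear_le_base n]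

/-- `3 D + 1 ≤ N`. [folklore] -/
theorem three_D_succ_le (n : ℕ) : 3 * (treeParams n).D + 1 ≤ base n ^ 1 := by
  rw [treeParams_D, pow_one]; linarith [linear_le_base n]

/-- `L + 3 ≤ N²`. [folklore] -/
theorem L_add_three_le (n : ℕ) : (treeParams n).L + 3 ≤ base n ^ 2 := by
  have hL : (treeParams n).L ≤ 2 * base n := by
    show LOf n (n + 1) ≤ 2 * base n
    have := LOf_le n (n + 1); unfold base; nlinarith
  have := base_ge n
  nlinarith

/-- `W + 1 ≤ N²`. [folklore] -/
theorem W_succ_le (n : ℕ) : (treeParams n).W + 1 ≤ base n ^ 2 := by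
  have hW : (treeParams n).W ≤ 8 * base n := by
    show WOf n (n + 1) ≤ 8 * base n
    have := WOf_le n (n + 1); unfold base; nlinarith
  have := base_ge n
  nlinarith

/-- `1 + Wf ≤ N²`. [folklore] -/
theorem Wf_succ_le (n : ℕ) : 1 + (treeParams n).Wf ≤ base n ^ 2 := by
  have hWf : (treeParams n).Wf = (n + 1) * (n + 3) := by
    show (n + 1) * (Nat.size (2 ^ (n + 1)) + 1) = (n + 1) * (n + 3)
    rw [Nat.size_pow]
  rw [hWf]
  have := wf_le_base n
  have := base_ge n
  nlinarith

/-- `Wa ≤ N⁴`. [folklore] -/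
theorem Wa_le (n : ℕ) : (treeParams n).Wa ≤ base n ^ 4 := by
  show (treeParams n).W + (treeParams n).D * ((treeParams n).W + 1) ≤ base n ^ 4
  have hb := base_ge n
  have hD : (treeParams n).D ≤ base n ^ 1 := by have := D_add_two_le n; rw [pow_one] at this ⊢; omega
  refine add_le_pow_of_le (by omega) (i := 2) (j := 3) (by have := W_succ_le n; omega) ?_ (by norm_num) (by norm_num)
  exact mul_le_pow_of_le (by omega) hD (W_succ_le n) (by norm_num)

/-- Exact length of the tasks of a level. [folklore] -/
theorem length_levelTasks (Q : LevelParams) (j : ℕ) :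
    (levelTasks Q j).length =
      (if j = 0 then 0 else Q.D * (Q.L + 1) + (Q.D + 1) * ((Q.D + 1) * (1 + Q.Wf) + 1) + Q.Wa) + 2 * Q.D + Q.D + 1 := by
  unfold levelTasks
  split_ifs with hj
  · simp [List.length_flatMap, List.map_const', List.sum_replicate]
    ring
  · simp only [List.length_append, List.length_flatMap, List.length_map, List.length_range,
      List.length_cons, List.map_const', List.sum_replicate, smul_eq_mul, List.length_finRange, List.length_nil]
    ring

/-- Length of the schedule. [folklore] -/
theorem length_agenda_le (Q : LevelParams) :
    (agenda Q).length ≤ (Q.D + 1) * (Q.D * (Q.L + 1) + (Q.D + 1) * ((Q.D + 1) * (1 + Q.Wf) + 1) + Q.Wa + 3 * Q.D + 1) := by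
  unfold agenda
  rw [List.length_flatMap]
  calc ((List.range (Q.D + 1)).map (List.length ∘ levelTasks Q)).sum
      ≤ ((List.range (Q.D + 1)).map fun _ => Q.D * (Q.L + 1) + (Q.D + 1) * ((Q.D + 1) * (1 + Q.Wf) + 1) + Q.Wa + 3 * Q.D + 1).sum := by
        refine List.sum_le_sum fun j _ => ?_
        simp only [Function.comp_apply, length_levelTasks]
        split_ifs <;> omega
    _ = _ := by simp [List.map_const', List.sum_replicate]

/-- **The schedule is polynomially long**: `|agenda (treeParams n)| ≤ N⁸`. [cite: FournierKoiran2000, Thm 2] -/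
theorem length_agenda_treeParams_le (n : ℕ) : (agenda (treeParams n)).length ≤ base n ^ 8 := by
  have hb := base_ge n
  have h1N : 1 ≤ base n := by omega
  have h2N : 2 ≤ base n := by omega
  have hD1 : (treeParams n).D + 1 ≤ base n ^ 1 := by have := D_add_two_le n; rw [pow_one] at this ⊢; omega
  have hD : (treeParams n).D ≤ base n ^ 1 := by rw [pow_one] at hD1 ⊢; omega
  have hL : (treeParams n).L + 1 ≤ base n ^ 2 := by have := L_add_three_le n; omega
  have h1 : (treeParams n).D * ((treeParams n).L + 1) ≤ base n ^ 3 := mul_le_pow_of_le h1N hD hL (by norm_num)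
  have h2 : ((treeParams n).D + 1) * (((treeParams n).D + 1) * (1 + (treeParams n).Wf) + 1) ≤ base n ^ 5 := by
    refine mul_le_pow_of_le h1N hD1 (j := 4) ?_ (by norm_num)
    refine add_le_pow_of_le h2N (i := 3) (j := 0) ?_ (by simp) (by norm_num) (by norm_num)
    exact mul_le_pow_of_le h1N hD1 (Wf_succ_le n) (by norm_num)
  have h3 : (treeParams n).Wa + (3 * (treeParams n).D + 1) ≤ base n ^ 5 :=
    add_le_pow_of_le h2N (Wa_le n) (three_D_succ_le n) (by norm_num) (by norm_num)
  have h123 : (treeParams n).D * ((treeParams n).L + 1) +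
      ((treeParams n).D + 1) * (((treeParams n).D + 1) * (1 + (treeParams n).Wf) + 1) + (treeParams n).Wa +
      3 * (treeParams n).D + 1 ≤ base n ^ 7 := by
    have h12 := add_le_pow_of_le h2N h1 h2 (show 3 < 6 by norm_num) (show 5 < 6 by norm_num)
    have := add_le_pow_of_le h2N h12 h3 (show 6 < 7 by norm_num) (show 5 < 7 by norm_num)
    omega
  exact (length_agenda_le _).trans (mul_le_pow_of_le h1N hD1 h123 (by norm_num))

/-- **The number of rounds is polynomial**: `|agenda (treeParams n)| + 1 ≤ treeBudget n`. [cite: FournierKoiran2000, Thm 2] -/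
theorem length_agenda_treeParams_succ_le (n : ℕ) : (agenda (treeParams n)).length + 1 ≤ treeBudget n := by
  have hb := base_ge n
  exact add_le_pow_of_le (show 2 ≤ base n by omega) (length_agenda_treeParams_le n)
    (show 1 ≤ base n ^ 0 by simp) (show 8 < 24 by norm_num) (show 0 < 24 by norm_num)

/-- **The size exponent is polynomial**: `sizeExp (treeParams n) ≤ N²⁰`. [cite: FournierKoiran2000, §2.2] -/
theorem sizeExp_treeParams_le (n : ℕ) : sizeExp (treeParams n) ≤ base n ^ 20 := by
  have hb := base_ge n
  have h1N : 1 ≤ base n := by omega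
  have h2N : 2 ≤ base n := by omega
  have hT := length_agenda_treeParams_le n
  have hK : (treeParams n).W + 1 + (agenda (treeParams n)).length ≤ base n ^ 9 :=
    add_le_pow_of_le h2N (W_succ_le n) hT (by norm_num) (by norm_num)
  have h2K : 2 * ((treeParams n).W + 1 + (agenda (treeParams n)).length) ≤ base n ^ 10 := by
    rw [two_mul]; exact add_le_pow_of_le h2N hK hK (by norm_num) (by norm_num)
  have hA : 2 * ((treeParams n).W + 1 + (agenda (treeParams n)).length) + (treeParams n).L + 3 ≤ base n ^ 11 := by
    rw [add_assoc]; exact add_le_pow_of_le h2N h2K (L_add_three_le n) (by norm_num) (by norm_num)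
  have hB : 2 * ((treeParams n).W + 1 + (agenda (treeParams n)).length) + (treeParams n).D + 2 ≤ base n ^ 11 := by
    rw [add_assoc]; exact add_le_pow_of_le h2N h2K (D_add_two_le n) (by norm_num) (by norm_num)
  unfold sizeExp
  exact add_le_pow_of_le h2N hA (mul_le_pow_of_le h1N hT hB (show 8 + 11 ≤ 19 by norm_num)) (by norm_num) (by norm_num)

/-- **The queries are polynomially short**: a form with `FormBnd (sizeExp (treeParams n))` has a code of
length `≤ treeBudget n`. [cite: FournierKoiran2000, §2.2] -/
theorem length_encHat_le_treeBudget (n : ℕ) {φ : AffForm (n + 1)} (hφ : FormBnd (sizeExp (treeParams n)) φ) :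
    (encHat n φ).length ≤ treeBudget n := by
  have hb := base_ge n
  have h1N : 1 ≤ base n := by omega
  have h2N : 2 ≤ base n := by omega
  have hS := sizeExp_treeParams_le n
  refine (length_encHat_le hφ.1 hφ.2).trans ?_
  have hn : 2 * (n + 1) + 2 ≤ base n ^ 1 := by rw [pow_one]; linarith [linear_le_base n]
  have hn1 : n + 1 ≤ base n ^ 1 := by rw [pow_one]; linarith [linear_le_base n]
  have h14 : 14 ≤ base n ^ 1 := by rw [pow_one]; omega
  have hin : 2 * (sizeExp (treeParams n) + 1 + 5) + 2 ≤ base n ^ 22 := by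
    have e : 2 * (sizeExp (treeParams n) + 1 + 5) + 2 = (sizeExp (treeParams n) + sizeExp (treeParams n)) + 14 := by ring
    rw [e]
    exact add_le_pow_of_le h2N (add_le_pow_of_le h2N hS hS (show 20 < 21 by norm_num) (show 20 < 21 by norm_num))
      h14 (by norm_num) (by norm_num)
  exact add_le_pow_of_le h2N hn (mul_le_pow_of_le h1N hn1 hin (show 1 + 22 ≤ 23 by norm_num)) (by norm_num) (by norm_num)

end Params

/-! ### The theorem -/

section Locate

variable {n : ℕ}

/-- The de-homogenised located point of a certificate: `x*_{<n} / x*_n`. [cite: FournierKoiran2000, §2.3–2.4 and p. 11] -/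
noncomputable def dehom (n : ℕ) (Γ : Cert (n + 1)) : Fin n → ℝ :=
  fun i => (Γ.xStar 0 i.castSucc : ℝ) / (Γ.xStar 0 (Fin.last n) : ℝ)

/-- Sign agreement of two points of `ℝⁿ` on all integer affine forms with coefficients and constant
bounded by `Bd`. [cite: FournierKoiran2000, §2 (the face of `x` in `𝒜(ℋₙ)`)] -/
def SignAgree (Bd : ℕ) (x x' : Fin n → ℝ) : Prop :=
  ∀ (a : Fin n → ℤ) (c : ℤ), (∀ i, (a i).natAbs ≤ Bd) → c.natAbs ≤ Bd →
    SignType.sign ((c : ℝ) + ∑ i, (a i : ℝ) * x i) = SignType.sign ((c : ℝ) + ∑ i, (a i : ℝ) * x' i)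

/-- **The located point lies in the face of the input**: for the final state of the truthful run on
`x̂`, the de-homogenised located point sign-agrees with `x` at bound `2^{n+1}`.
[cite: FournierKoiran2000, Thm 2 with §2.3–2.4] -/
theorem signAgree_dehom_finalData (finT : Cert (n + 1) → Prop) (x : Fin n → ℝ) :
    SignAgree (2 ^ (n + 1)) x (dehom n (certOf (treeParams n) (finalData (treeParams n) finT (hat x)))) := by
  have hx : ∃ i, hat x i ≠ 0 := ⟨Fin.last n, by simp [hat]⟩
  have hV := finalData_valid (Q := treeParams n) (finT := finT) hx
  have hagree := Cert.sign_lin_xStar_eq hV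
  have := affine_sign_agree_of_homogeneous x (fun i => ((certOf (treeParams n) (finalData (treeParams n) finT (hat x))).xStar 0 i : ℝ))
    (B := 2 ^ (n + 1)) Nat.one_le_two_pow (fun a ha => hagree a ha)
  exact fun a c ha hc => this.2 a c ha hc

open Classical in
/-- The output of the tree for a property `P`: `P` at the de-homogenised located point of the state.
[cite: FournierKoiran2000, Thm 3 p. 11 (membership is decided at a rational point of the located face)] -/
noncomputable def outP (P : (Fin n → ℝ) → Prop) (dat : Data (n + 1)) : Bool :=
  decide (P (dehom n (certOf (treeParams n) dat)))

/-- **Non-uniform point location (Meyer auf der Heide; Fournier–Koiran): sign-determined properties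
have polynomial-depth sign-query trees with polynomially short queries.** For every `n` and every
property `P` of points of `ℝⁿ` that is determined by the signs of the integer affine forms with
coefficients and constant bounded by `2^{n+1}`, there is an oracle algorithm (arbitrary step function)
which, against the sign oracle of any `x ∈ ℝⁿ` and on any Boolean input, within any budget
`k ≥ treeBudget n` outputs `[P x]`, all its queries having length `≤ treeBudget n`.
[cite: FournierKoiran2000, Thm 2 (report p. 4) with §2.2–2.4; after MeyerAufDerHeide1988 and FournierKoiran1998 (polynomial-depth parameter-free trees)] -/
theorem exists_treeAlg_of_signDetermined (n : ℕ) (P : (Fin n → ℝ) → Prop)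
    (hP : ∀ x x' : Fin n → ℝ, SignAgree (2 ^ (n + 1)) x x' → (P x ↔ P x')) :
    ∃ M : OracleAlg Bool, ∀ (x : Fin n → ℝ) (inp : List Bool) (k : ℕ), treeBudget n ≤ k →
      M.run (signOracle x) k inp = some (@decide (P x) (Classical.dec _)) ∧
        ∀ y ∈ M.queries (signOracle x) k inp, y.length ≤ treeBudget n := by
  refine ⟨treeAlg (treeParams n) (fun _ => True) (outP P) (encHat n), fun x inp k hk => ?_⟩
  have hO : ∀ φ : AffForm (treeParams n).D, signOracle x (encHat n φ) = encodeBool (decide (0 ≤ aff φ (hat x))) :=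
    signOracle_encHat x
  constructor
  · rw [treeAlg_run (finT := fun _ => True) (out := outP P) hO inp ((length_agenda_treeParams_succ_le n).trans hk)]
    congr 1
    have hiff := hP _ _ (signAgree_dehom_finalData (fun _ => True) x)
    unfold outP
    exact decide_eq_decide.mpr hiff.symm
  · intro y hy
    obtain ⟨s, hs, hy'⟩ := mem_queries_treeAlg (Q := treeParams n) (finT := fun _ => True) (out := outP P)
      (enc := encHat n) (O := signOracle x) (xh := hat x) hO inp k hy
    rw [hy']
    exact length_encHat_le_treeBudget n (formBnd_formAt (treeParams n) _ _ hs)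

/-- The same with the polynomial `treeBudgetPoly` (`treeBudgetPoly.eval n = treeBudget n`), in the
shape of non-uniform sign-query statements of the tree (`∃ q, ∀ n, ∃ M, ∀ x, …`).
[cite: FournierKoiran2000, Thm 2 (report p. 4); after MeyerAufDerHeide1988 and FournierKoiran1998] -/
theorem exists_poly_treeAlg_of_signDetermined (P : (n : ℕ) → (Fin n → ℝ) → Prop)
    (hP : ∀ (n : ℕ) (x x' : Fin n → ℝ), SignAgree (2 ^ (n + 1)) x x' → (P n x ↔ P n x')) :
    ∃ q : Polynomial ℕ, ∀ n : ℕ, ∃ M : OracleAlg Bool, ∀ x : Fin n → ℝ,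
      M.run (signOracle x) (q.eval n) (unaryEncodeNat n) = some (@decide (P n x) (Classical.dec _)) ∧
        ∀ y ∈ M.queries (signOracle x) (q.eval n) (unaryEncodeNat n), y.length ≤ q.eval n := by
  refine ⟨treeBudgetPoly, fun n => ?_⟩
  obtain ⟨M, hM⟩ := exists_treeAlg_of_signDetermined n (P n) (hP n)
  refine ⟨M, fun x => ?_⟩
  rw [eval_treeBudgetPoly]
  exact hM x _ _ le_rfl

end Locate

end FKPointLocation

end Literature.Computability.Complexity
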